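import Summits.QuantumFields.QCD.Theorems.PauliWegnerSeaFMClosureUnquenchedDefs
import Summits.QuantumFields.QCD.Theses.GaussianLinkFrames

/-!
# Sketch — crux `FrameFMClosure` (stmt-QuantumFields-17375), idea `defect-ratio-tame-line` (ideator 2, round 1)

First-lemma statements only (no proofs claimed).  Vocabulary = the landed proof-side definitions of the
sibling crux (`VonMisesCircles.pqE / blockNorm / wilsonD / gside / ball / sphere / cruxMoment / bareMass`).

* `DefectRatioBound`  — the phase-quenched FIRST moment (s = 1) of one propagator entry, written as what it
  is over the untilted Wilson measure: a ratio of two absolute fermionic partition functions that differ by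
  ONE row of the probe's Wilson–Dirac matrix (`Matrix.adjugate_apply`: `adj D i j = det (D.updateRow j (Pi.single i 1))`,
  `Matrix.inv_def`: `D⁻¹ = det⁻¹ • adj`), i.e. `E_μ[∏_{f'≠f}|det D_{f'}| · |det D_f^{(j ← e_i)}|] ≤ C(1+|β|)^p E_μ[∏|det|]`.
* `TameApriori`       — ASFH's a-priori clause (T5) for every `s ∈ (0,1]`; `DefectRatioBound → TameApriori` is
  Jensen (`t ↦ t^s` concave, `pqE` a probability expectation) + the 144-term block sum: provable now.
* `MixedFarStability` — far stability whose SMALL factor is the FULL-torus shell moment (the crux's own input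
  quantity at radius `r = ℓ₀`) and whose linear factor is the ball-complement Green function of ASFH (Rfwd).
* `DepletedToFullMean` — (Rout)+(Tdec) merged into one AVERAGED comparison: the mean of the ball-complement
  moment from a wall point is at most `poly ·` full-torus moments from the two adjacent shells.
* `TameCoreOutward`   — the claimed composition (same conclusion as the landed
  `VonMisesCirclesC2B.coreOutward_of_twoStarBounds_farStability`, p149039): no `LocalCofactorDomination`, no
  side matrices other than ball complements, no (T1), no box-to-full conversion of the input.
-/

noncomputable section

namespace Summit.QuantumFields.QCD.Cruxes.FrameFMClosure.DefectRatio

open scoped BigOperators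
open MeasureTheory Filter
open Literature.MathematicalPhysics.QuantumFieldTheory Literature.MathematicalPhysics.QuantumLattice
  Literature.Probability.LatticeModels
open Summit.QuantumFields.QCD.Theorems.VonMisesCircles

/-- **Defect-ratio bound** (= (T5) at `s = 1`, K1♭-free form).  For the probe flavour `f` (mass in `[-9,1]`),
every volume, coupling, sea, and every pair of quark indices `i, j`:
`pqE[ |det(D_f with row j replaced by e_i)| / |det D_f| ] ≤ C (1+|β|)^p`.
Over `μ_W` the `|det D_f|` of the weight cancels the denominator, so this is the ratio of the glue average of the
ABSOLUTE two-point Grassmann numerator `|∫ψ_i ψ̄_j e^{-ψ̄D_fψ}|` to the glue average of `|∫e^{-ψ̄D_fψ}|`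
(other flavours' `|det|` riding along): an `O(1)` free-energy cost for one local fermionic defect. -/
def DefectRatioBound (Nf : ℕ) : Prop :=
  ∃ C p : ℝ, 0 < C ∧ ∀ (β : ℝ) (mq : Fin Nf → ℝ) (f : Fin Nf), -9 ≤ mq f → mq f ≤ 1 →
    ∀ (S : ℕ) (i j : QIdx (2 * S + 1)),
      pqE Nf S β mq (fun U =>
          ‖((wilsonD U (mq f)).updateRow j (Pi.single i 1)).det‖ / ‖(wilsonD U (mq f)).det‖) ≤
        C * (1 + |β|) ^ p

/-- **Fractional defect ratio** (the safe `s < 1` member of the family; entry-wise this IS ASFH's (T5) written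
tamely): `pqE[ |det D_f^{(j←e_i)}|^s / |det D_f|^s ] ≤ C(1+|β|)^p`, i.e. over `μ_W` the bounded integrand
`|det D_f^{(j←e_i)}|^s |det D_f|^{1-s} ∏_{f'≠f}|det D_{f'}|` against `E_μ ∏|det|` — no negative power of any
polynomial anywhere (full-torus factors are protected by the tilt; Dirichlet factors are not). -/
def DefectRatioFrac (Nf : ℕ) : Prop :=
  ∃ s₀ C p : ℝ, 0 < s₀ ∧ s₀ < 1 ∧ 0 < C ∧ ∀ s : ℝ, 0 < s → s ≤ s₀ →
    ∀ (β : ℝ) (mq : Fin Nf → ℝ) (f : Fin Nf), -9 ≤ mq f → mq f ≤ 1 →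
    ∀ (S : ℕ) (i j : QIdx (2 * S + 1)),
      pqE Nf S β mq (fun U =>
          (‖((wilsonD U (mq f)).updateRow j (Pi.single i 1)).det‖ / ‖(wilsonD U (mq f)).det‖) ^ s) ≤
        C * (1 + |β|) ^ p

/-- **Tame a-priori bound**: ASFH's clause (T5) for EVERY exponent `s ∈ (0,1]` (not only `s ≤ s₀ < 1`), uniform in
volume, sites, sea and coupling up to `(1+|β|)^p`. -/
def TameApriori (Nf : ℕ) : Prop :=
  ∃ C p : ℝ, 0 < C ∧ ∀ s : ℝ, 0 < s → s ≤ 1 →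
    ∀ (β : ℝ) (mq : Fin Nf → ℝ) (f : Fin Nf), -9 ≤ mq f → mq f ≤ 1 →
      ∀ (S : ℕ) (x y : TorusSite 4 (2 * S + 1)),
        pqE Nf S β mq (fun U => blockNorm (wilsonD U (mq f))⁻¹ x y ^ s) ≤ C * (1 + |β|) ^ p

/-- The first lemma of the line (provable now: Jensen for the concave power under the probability expectation
`pqE`, `blockNorm = Σ` of 144 entries, `|(D⁻¹) i j| = |adj D i j| / |det D|`). -/
def AprioriOfDefect (Nf : ℕ) : Prop := DefectRatioBound Nf → TameApriori Nf

/-- **Mixed far stability** (the ONE physical stub of the tame line).  Geometry of ASFH (Rfwd): centre `x`, shell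
`p ∈ sphere r`, `p' ∈ sphere (r+1)`, target `z` outside `ball (r+1)`.  The SMALL factor is the full-torus shell
moment `‖G(x,p)‖^s` — verbatim the crux's input quantity when `r = ℓ₀` — raised to a power `θ`; the LINEAR factor is
the ball-complement Green function that (Rfwd) produces.  No Dirichlet box around `x`, no collar, no (T1). -/
def MixedFarStability (Nf : ℕ) : Prop :=
  ∃ s₀ C p θ : ℝ, 0 < s₀ ∧ s₀ < 1 ∧ 0 < C ∧ 0 < θ ∧ θ ≤ 1 ∧ ∀ s : ℝ, 0 < s → s ≤ s₀ →
  ∀ (β : ℝ) (mq : Fin Nf → ℝ) (f : Fin Nf), -9 ≤ mq f → mq f ≤ 1 →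
  ∀ (S : ℕ) (x : TorusSite 4 (2 * S + 1)) (r : ℕ), 1 ≤ r → r + 2 ≤ S →
  ∀ u u' z : TorusSite 4 (2 * S + 1),
    u ∈ sphere S x r → u' ∈ sphere S x (r + 1) → z ∉ ball S x (r + 1) →
    pqE Nf S β mq (fun U =>
        blockNorm (wilsonD U (mq f))⁻¹ x u ^ s *
          blockNorm (gside (ball S x r)ᶜ (wilsonD U (mq f))) u' z ^ s) ≤
      C * (1 + |β|) ^ p * (1 + (r : ℝ)) ^ p *
        (pqE Nf S β mq (fun U => blockNorm (wilsonD U (mq f))⁻¹ x u ^ s) ^ θ +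
          pqE Nf S β mq (fun U => blockNorm (wilsonD U (mq f))⁻¹ x u ^ s)) *
        pqE Nf S β mq (fun U => blockNorm (gside (ball S x r)ᶜ (wilsonD U (mq f))) u' z ^ s)

/-- **Depleted-to-full comparison in MEAN** ((Rout) + (Tdec) of ASFH merged into one averaged statement): the mean
ball-complement moment from a wall point `u'` to `z` is at most `poly ·` the sum of FULL-torus moments to `z` from the
two shells `r`, `r+1`.  No sup over backgrounds, no cofactor domination; false direction of surface states is
harmless (they only propagate ALONG the wall, and the right side contains the same wall points). -/
def DepletedToFullMean (Nf : ℕ) : Prop :=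
  ∃ s₀ C p : ℝ, 0 < s₀ ∧ s₀ < 1 ∧ 0 < C ∧ ∀ s : ℝ, 0 < s → s ≤ s₀ →
  ∀ (β : ℝ) (mq : Fin Nf → ℝ) (f : Fin Nf), -9 ≤ mq f → mq f ≤ 1 →
  ∀ (S : ℕ) (x : TorusSite 4 (2 * S + 1)) (r : ℕ), 1 ≤ r → r + 2 ≤ S →
  ∀ u' z : TorusSite 4 (2 * S + 1), u' ∈ sphere S x (r + 1) → z ∉ ball S x (r + 1) →
    pqE Nf S β mq (fun U => blockNorm (gside (ball S x r)ᶜ (wilsonD U (mq f))) u' z ^ s) ≤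
      C * (1 + |β|) ^ p * (1 + (r : ℝ)) ^ p *
        ∑ w ∈ sphere S x r ∪ sphere S x (r + 1), pqE Nf S β mq (fun U => blockNorm (wilsonD U (mq f))⁻¹ w z ^ s)

/-- **The tame line's composition target** (to be proved by the line's lead; same conclusion, integrand by
integrand, as the landed `VonMisesCirclesC2B.coreOutward_of_twoStarBounds_farStability`): one-scale input with
`2 ≤ ℓ₀` ⇒ clause (ii) OUTWARD.  Mechanism: (Rfwd) at radius `ℓ₀` (landed `collarResolventBounds_holds`, `cT = 4`)
→ `MixedFarStability` (input smallness enters through the FULL shell factor, no conversion) → `DepletedToFullMean`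
→ the abstract outward bootstrap (sibling Disproof §6 `outward_bootstrap`, annulus variant) with prefactor from
`TameApriori`. -/
def TameCoreOutward : Prop :=
  (∀ Nf : ℕ, DefectRatioBound Nf) → (∀ Nf : ℕ, MixedFarStability Nf) → (∀ Nf : ℕ, DepletedToFullMean Nf) →
    ∀ (Nf : ℕ) (reg : QCDRegularisation Nf) (m : Fin Nf → ℝ),
      (∀ q : ℕ, ∃ K₀ s : ℝ, 0 < s ∧ s < 1 ∧ ∀ᶠ k in atTop, ∃ ℓ₀ : ℕ, 2 ≤ ℓ₀ ∧ ℓ₀ ≤ reg.L k ∧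
        (ℓ₀ : ℝ) * reg.a k ≤ K₀ * (1 + |Real.log (reg.a k)|) ∧
        ∀ S : ℕ, reg.L k ≤ S → ∀ (f : Fin Nf) (v : Literature.Probability.LatticeModels.Site 4),
          v ∈ box 4 S → ‖v‖ = (ℓ₀ : ℝ) →
            (ℓ₀ : ℝ) ^ q * (1 + |reg.β k|) ^ q * cruxMoment Nf (reg.β k) (bareMass reg m k) S f v s ≤ 1) →
      ∃ s δ C K : ℝ, 0 < s ∧ s < 1 ∧ 0 < δ ∧ ∀ᶠ k in atTop, ∀ S : ℕ, reg.L k ≤ S →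
        ∀ (f : Fin Nf) (v : Literature.Probability.LatticeModels.Site 4), v ∈ box 4 S →
          K * (1 + |Real.log (reg.a k)|) ≤ reg.a k * ‖v‖ →
            cruxMoment Nf (reg.β k) (bareMass reg m k) S f v s ≤ C * Real.exp (-(δ * (reg.a k * ‖v‖)))

/-- Pointwise algebra behind `AprioriOfDefect` (sanity anchor): an inverse entry is the row-replaced determinant over
the determinant. -/
theorem inv_entry_eq_updateRow_det {n : Type*} [Fintype n] [DecidableEq n] (D : Matrix n n ℂ) (i j : n) :
    D⁻¹ i j = (D.updateRow j (Pi.single i 1)).det / D.det := by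
  rw [Matrix.inv_def, Matrix.smul_apply, Matrix.adjugate_apply, smul_eq_mul, div_eq_inv_mul, Ring.inverse_eq_inv']

end Summit.QuantumFields.QCD.Cruxes.FrameFMClosure.DefectRatio
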